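import Literature.MathematicalPhysics.QuantumLattice.CoordinateSlabs
import Literature.MathematicalPhysics.QuantumLattice.HubbardGaugeBound
import Literature.MathematicalPhysics.QuantumLattice.ClusteringFromCommutatorBounds
import Literature.MathematicalPhysics.QuantumLattice.QuasiAdiabaticGenerator
import HarnessLib

/-!
# Locality in one coordinate direction for the Hubbard model: Lieb–Robinson bound, clustering,
# boundary currents and the quasi-adiabatic operators `K`, `K̃`

Generic analytic layer (arbitrary finite graph `G`, coordinate function `coord : Λ → ℤ/L`, degree
bound `Δ`) for the Lieb–Schultz–Mattis case of Bachmann–Bols–De Roeck–Fraas, Comm. Math. Phys.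
**375** (2019) 1249 (BBDF), Proposition 2.4 and Assumptions (iv), (v). Everything is PROVED
(definitions with bodies + theorems, no named facts):

* `coord_lr_of_nonneg`, `coord_lr` — the fermionic Lieb–Robinson bound
  (`fermion_lieb_robinson_hamiltonianWith`) in the coordinate direction, for both time directions:
  `‖[τ_u(A), B]‖ ≤ 4J(2Δ+1) max(|X|,|Y|) ‖A‖‖B‖ |u| e^{κ|u| - (D-1)}` for commuting `A ∈ 𝔄(X)`,
  `B ∈ 𝔄(Y)` at `x₁`-distance `D` (`J = hubbardJ`, `κ = lrRate Δ`).
* `coord_clustering` — **exponential clustering of the unique gapped ground state in the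
  coordinate direction** (BBDF Assumption (v) via Prop. 2.4), from `coord_lr`, the Lipschitz input
  `norm_commutator_hamiltonianWith_le_of_mem` and the generic Hastings–Koma assembly
  `clustering_of_commutator_bounds`.
* `windowCurrent` — the part `J(S,P)` of `[Q^σ_{slab S}, H]` through a window slab `P` (even,
  anti-Hermitian, local, `‖J‖ ≤ |slab P|(2Δ+1)·4J`) and the decomposition
  `setCharge_commutator_eq_add_windowCurrent` (`[Q,H] = J₁ + J₂`, BBDF proof of Prop. 2.4).
* `kTilde = i𝓘^H_γ(J)` and the strictly local `kLoc = i𝓘^{H_B}_γ(J)` (Hermitian; `kLoc_mem`: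
  `K ∈ 𝔄⁺(slab B)`), **the ground state is an EXACT eigenvector of `Q - K̃₁ - K̃₂`**
  (`setCharge_sub_kTilde_mulVec`, from `qaGenerator_intertwines`), and the quantitative locality
  `norm_kLoc_sub_kTilde_le`: `‖K - K̃‖ ≤ ηT‖W₁‖₁/γ + 4‖J‖C_k γ⁻¹(1+γT)^{-(k+1)}` with
  `η = |Λ|(2Δ+1)·4J(2Δ+1)max(2,|slab P|)J‖J‖Te^{κT-(R-1)}` whenever the terms outside the ball `B`
  stay at `x₁`-distance `≥ R` from the window (BBDF: `K̃_± = K_± + O(L^{-∞})`).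

## References

* S. Bachmann, A. Bols, W. De Roeck, M. Fraas, Comm. Math. Phys. **375** (2019) 1249, Prop. 2.4
  (proof), Assumptions (iv)–(v). [BachmannEtAl2019]
* M. B. Hastings, T. Koma, CMP **265** (2006) 781, Thm. 8. [HastingsKomaCMP2006]
* The tree: `FermionLiebRobinson`, `ClusteringFromCommutatorBounds`, `QuasiAdiabaticGenerator`,
  `CoordinateSlabs`, `HubbardTorusCharges`.
-/

noncomputable section

namespace Literature.MathematicalPhysics.QuantumLattice

open Matrix Complex Finset HubbardWave0
open scoped Matrix.Norms.L2Operator ComplexOrder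

section CoordLR

variable {Λ : Type*} [LinearOrder Λ] [Fintype Λ] (G : SimpleGraph Λ) [DecidableRel G.Adj]
variable {L : ℕ} (coord : Λ → ZMod L)

omit [Fintype Λ] [DecidableRel G.Adj] in
/-- On the support of a term meeting `X`, the level is at least `D - 1`. [folklore] -/
theorem le_inf_clevel_of_not_disjoint [NeZero L] (hc : IsCoordFn coord G) {X Y : Finset Λ} (hY : Y.Nonempty) {D : ℕ}
    (hD : ∀ x ∈ X, ∀ y ∈ Y, D ≤ circDist (coord x) (coord y)) {Z : HubbardIdx G}
    (hZ : ¬ Disjoint (hubbardTermSupp G Z) X) :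
    D ≤ (hubbardTermSupp G Z).inf' (hubbardTermSupp_nonempty _ Z) (clevel coord Y hY) + 1 := by
  obtain ⟨x, hxZ, hxX⟩ := Finset.not_disjoint_iff.1 hZ
  obtain ⟨z, hz, hmin⟩ := Finset.exists_mem_eq_inf' (hubbardTermSupp_nonempty _ Z) (clevel coord Y hY)
  rw [hmin]
  have hDx := le_clevel coord hY hD hxX
  rcases eq_or_adj_of_mem_hubbardTermSupp G hz hxZ with rfl | hadj
  · exact hDx.trans (Nat.le_succ _)
  · have := clevel_le_of_adj coord hc hY (G.adj_symm hadj)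
    omega

/-- The interaction strength `J = 2|t| + |U| + 2|μ|` of the Hubbard terms. [folklore] -/
def hubbardJ (t U μ : ℝ) : ℝ := 2 * |t| + |U| + 2 * |μ|

/-- `J ≥ 0`. [folklore] -/
theorem hubbardJ_nonneg (t U μ : ℝ) : 0 ≤ hubbardJ t U μ := by unfold hubbardJ; positivity

/-- The Lieb–Robinson rate `κ = 2eJ · 2(2Δ + 1)` for degree bound `Δ`. [folklore] -/
def lrRate (Δ : ℕ) (t U μ : ℝ) : ℝ := Real.exp 1 * (2 * hubbardJ t U μ * (2 * (2 * Δ + 1) : ℕ))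

/-- `κ ≥ 0`. [folklore] -/
theorem lrRate_nonneg (Δ : ℕ) (t U μ : ℝ) : 0 ≤ lrRate Δ t U μ := by
  unfold lrRate; have := hubbardJ_nonneg t U μ; positivity

/-- **One-sided Lieb–Robinson bound in the coordinate direction** (`s ≥ 0`): for `A ∈ 𝔄(X)`,
`B ∈ 𝔄(Y)` with `[A,B] = 0` and `x₁`-distance `≥ D` between `X` and `Y`,
`‖[τ_s(A), B]‖ ≤ 4J(2Δ+1) |X| ‖A‖‖B‖ s e^{κs - (D-1)}` (the fermionic Lieb–Robinson bound
`fermion_lieb_robinson_hamiltonianWith` with the level function `clevel`). [folklore] -/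
theorem coord_lr_of_nonneg [NeZero L] (hc : IsCoordFn coord G) {Δ : ℕ}
    (hΔ : ∀ x : Λ, (Finset.univ.filter fun y => G.Adj x y).card ≤ Δ) (t U μ : ℝ) {X Y : Finset Λ}
    {A B : Matrix (Finset (Orb Λ)) (Finset (Orb Λ)) ℂ}
    (hA : A ∈ carSubalgebra (orbSet X)) (hB : B ∈ carSubalgebra (orbSet Y)) (hAB : A * B = B * A)
    (hY : Y.Nonempty) {D : ℕ} (hD : ∀ x ∈ X, ∀ y ∈ Y, D ≤ circDist (coord x) (coord y))
    {s : ℝ} (hs : 0 ≤ s) :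
    ‖heisenbergEvolution (hamiltonianWith G t U μ) s A * B - B * heisenbergEvolution (hamiltonianWith G t U μ) s A‖ ≤
      4 * hubbardJ t U μ * (2 * Δ + 1) * X.card * ‖A‖ * ‖B‖ * s * Real.exp (lrRate Δ t U μ * s - (D - 1)) := by
  have h := fermion_lieb_robinson_hamiltonianWith (G := G) hΔ t U μ hA hB
    (clevel coord Y hY) (fun y hy => clevel_eq_zero coord hY hy) (fun x y hxy => clevel_le_of_adj coord hc hY hxy) hs
  have h0 : ‖A * B - B * A‖ = 0 := by
    rw [hAB, sub_self]
    exact norm_zero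
  rw [h0, zero_add] at h
  refine h.trans ?_
  have hJ := hubbardJ_nonneg t U μ
  have hterm : ∀ Z ∈ Finset.univ.filter (fun Z : HubbardIdx G => ¬ Disjoint (hubbardTermSupp G Z) X),
      2 * (2 * |t| + |U| + 2 * |μ|) * ‖B‖ * s *
        Real.exp (Real.exp 1 * (2 * (2 * |t| + |U| + 2 * |μ|) * (2 * (2 * Δ + 1) : ℕ)) * s -
          ((hubbardTermSupp G Z).inf' (hubbardTermSupp_nonempty _ Z) (clevel coord Y hY) : ℕ)) ≤
      2 * hubbardJ t U μ * ‖B‖ * s * Real.exp (lrRate Δ t U μ * s - (D - 1)) := by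
    intro Z hZ
    rw [Finset.mem_filter] at hZ
    have hℓ := le_inf_clevel_of_not_disjoint G coord hc hY hD hZ.2
    unfold hubbardJ lrRate hubbardJ
    gcongr
    · have : (D : ℝ) ≤ ((hubbardTermSupp G Z).inf' (hubbardTermSupp_nonempty _ Z) (clevel coord Y hY) : ℕ) + 1 := by
        exact_mod_cast hℓ
      linarith
  have hK : 0 ≤ 2 * hubbardJ t U μ * ‖B‖ * s * Real.exp (lrRate Δ t U μ * s - (D - 1)) :=
    mul_nonneg (mul_nonneg (mul_nonneg (by linarith) (norm_nonneg _)) hs) (Real.exp_nonneg _)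
  have hsum := Finset.sum_le_card_nsmul _ _ _ hterm
  rw [nsmul_eq_mul] at hsum
  have hcard : ((Finset.univ.filter (fun Z : HubbardIdx G => ¬ Disjoint (hubbardTermSupp G Z) X)).card : ℝ) ≤
      (X.card * (2 * Δ + 1) : ℕ) := by
    exact_mod_cast card_filter_not_disjoint_hubbardTermSupp_le G hΔ X
  have hA0 : 0 ≤ 2 * ‖A‖ := by positivity
  refine (mul_le_mul_of_nonneg_left (hsum.trans (mul_le_mul_of_nonneg_right hcard hK)) hA0).trans (le_of_eq ?_)
  push_cast
  ring

/-- **Two-sided Lieb–Robinson bound in the coordinate direction**: for `A ∈ 𝔄(X)`, `B ∈ 𝔄(Y)`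
commuting (e.g. one of them even, `x₁`-distance `D ≥ 1`) and all real times `u`,
`‖[τ_u(A), B]‖ ≤ 4J(2Δ+1) max(|X|,|Y|) ‖A‖‖B‖ |u| e^{κ|u| - (D-1)}`. [folklore] -/
theorem coord_lr [NeZero L] (hc : IsCoordFn coord G) {Δ : ℕ}
    (hΔ : ∀ x : Λ, (Finset.univ.filter fun y => G.Adj x y).card ≤ Δ) (t U μ : ℝ) {X Y : Finset Λ}
    {A B : Matrix (Finset (Orb Λ)) (Finset (Orb Λ)) ℂ}
    (hA : A ∈ carSubalgebra (orbSet X)) (hB : B ∈ carSubalgebra (orbSet Y)) (hAB : A * B = B * A)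
    (hX : X.Nonempty) (hY : Y.Nonempty) {D : ℕ} (hD : ∀ x ∈ X, ∀ y ∈ Y, D ≤ circDist (coord x) (coord y))
    (u : ℝ) :
    ‖heisenbergEvolution (hamiltonianWith G t U μ) u A * B - B * heisenbergEvolution (hamiltonianWith G t U μ) u A‖ ≤
      4 * hubbardJ t U μ * (2 * Δ + 1) * max X.card Y.card * ‖A‖ * ‖B‖ * |u| *
        Real.exp (lrRate Δ t U μ * |u| - (D - 1)) := by
  have hJ := hubbardJ_nonneg t U μ
  rcases le_or_gt 0 u with hu | hu
  · rw [abs_of_nonneg hu]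
    refine (coord_lr_of_nonneg G coord hc hΔ t U μ hA hB hAB hY hD hu).trans ?_
    gcongr
    exact_mod_cast le_max_left _ _
  · rw [norm_commutator_heisenbergEvolution_symm (isHermitian_hamiltonianWith G t U μ), abs_of_neg hu]
    have hD' : ∀ y ∈ Y, ∀ x ∈ X, D ≤ circDist (coord y) (coord x) := fun y hy x hx => by
      rw [circDist_comm]; exact hD x hx y hy
    refine (coord_lr_of_nonneg G coord hc hΔ t U μ hB hA hAB.symm hX hD' (by linarith : (0:ℝ) ≤ -u)).trans ?_
    have e : 4 * hubbardJ t U μ * (2 * ↑Δ + 1) * ↑Y.card * ‖B‖ * ‖A‖ * -u =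
        4 * hubbardJ t U μ * (2 * ↑Δ + 1) * ↑Y.card * ‖A‖ * ‖B‖ * -u := by ring
    rw [e]
    gcongr
    · linarith
    · exact_mod_cast le_max_right _ _

/-! ### Exponential clustering in the coordinate direction (BBDF Assumption (v)) -/

/-- **Locality of the commutator with the Hamiltonian**: for `B ∈ 𝔄(Y)`,
`‖[H, B]‖ ≤ 2‖B‖ |Y| (2Δ+1) J`. [folklore] -/
theorem norm_commutator_hamiltonianWith_le_of_mem {Δ : ℕ}
    (hΔ : ∀ x : Λ, (Finset.univ.filter fun y => G.Adj x y).card ≤ Δ) (t U μ : ℝ) {Y : Finset Λ}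
    {B : Matrix (Finset (Orb Λ)) (Finset (Orb Λ)) ℂ} (hB : B ∈ carSubalgebra (orbSet Y)) :
    ‖hamiltonianWith G t U μ * B - B * hamiltonianWith G t U μ‖ ≤
      2 * ‖B‖ * ((Y.card * (2 * Δ + 1) : ℕ) * hubbardJ t U μ) := by
  classical
  have hsum : hamiltonianWith G t U μ * B - B * hamiltonianWith G t U μ =
      ∑ Z ∈ Finset.univ.filter (fun Z : HubbardIdx G => ¬ Disjoint (hubbardTermSupp G Z) Y),
        (hubbardTermOp G t U μ Z * B - B * hubbardTermOp G t U μ Z) := by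
    rw [← sum_hubbardTermOp G t U μ, Finset.sum_mul, Finset.mul_sum, ← Finset.sum_sub_distrib,
      Finset.sum_filter]
    refine Finset.sum_congr rfl fun Z _ => ?_
    by_cases h : Disjoint (hubbardTermSupp G Z) Y
    · rw [if_neg (not_not.2 h)]
      exact sub_eq_zero.2 (commute_hubbardTermOp_of_disjoint G t U μ Z hB h).eq
    · rw [if_pos h]
  rw [hsum]
  have hterm : ∀ Z ∈ Finset.univ.filter (fun Z : HubbardIdx G => ¬ Disjoint (hubbardTermSupp G Z) Y),
      ‖hubbardTermOp G t U μ Z * B - B * hubbardTermOp G t U μ Z‖ ≤ 2 * hubbardJ t U μ * ‖B‖ := by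
    intro Z _
    refine (norm_commutator_le _ _).trans ?_
    have := norm_hubbardTermOp_le G t U μ Z
    unfold hubbardJ
    gcongr
  have h1 := Finset.sum_le_card_nsmul _ _ _ hterm
  rw [nsmul_eq_mul] at h1
  have hcard : ((Finset.univ.filter (fun Z : HubbardIdx G => ¬ Disjoint (hubbardTermSupp G Z) Y)).card : ℝ) ≤
      (Y.card * (2 * Δ + 1) : ℕ) := by exact_mod_cast card_filter_not_disjoint_hubbardTermSupp_le G hΔ Y
  have hJ := hubbardJ_nonneg t U μ
  refine (norm_sum_le _ _).trans (h1.trans ?_)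
  calc ((Finset.univ.filter (fun Z : HubbardIdx G => ¬ Disjoint (hubbardTermSupp G Z) Y)).card : ℝ) *
        (2 * hubbardJ t U μ * ‖B‖) ≤ (Y.card * (2 * Δ + 1) : ℕ) * (2 * hubbardJ t U μ * ‖B‖) :=
        mul_le_mul_of_nonneg_right hcard (by positivity)
    _ = 2 * ‖B‖ * ((Y.card * (2 * Δ + 1) : ℕ) * hubbardJ t U μ) := by ring

/-- `|u| e^{κ|u|} ≤ e^{(κ+1)|u|}`. [folklore] -/
theorem abs_mul_exp_le (κ u : ℝ) : |u| * Real.exp (κ * |u|) ≤ Real.exp ((κ + 1) * |u|) := by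
  have h1 : |u| ≤ Real.exp |u| := by linarith [Real.add_one_le_exp |u|, abs_nonneg u]
  calc |u| * Real.exp (κ * |u|) ≤ Real.exp |u| * Real.exp (κ * |u|) :=
        mul_le_mul_of_nonneg_right h1 (Real.exp_nonneg _)
    _ = Real.exp ((κ + 1) * |u|) := by rw [← Real.exp_add]; ring_nf

/-- **Exponential clustering of the unique gapped ground state of `H(t,U) - μN` in the coordinate
direction** (BBDF Assumption (v), via Prop. 2.4: "exponential clustering was proved in
[Hastings 2004], see also [Nachtergaele–Sims 2007]"; here from the fermionic Lieb–Robinson bound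
and the generic Hastings–Koma assembly `clustering_of_commutator_bounds`). For `A ∈ 𝔄(X)`,
`B ∈ 𝔄(Y)` commuting (e.g. one even) with `x₁`-distance `D` between `X`, `Y` satisfying
`D - 1 ≥ max(2(κ+1), 1)`:
`|⟨ψ,ABψ⟩ - ⟨ψ,Aψ⟩⟨ψ,Bψ⟩| ≤ K (2Δ+1) max(|X|,|Y|) ‖A‖‖B‖ e^{-(D-1)/ξ}` with
`K = 2 + 4J + 16J(2Δ+1)/(κ+1) + 8(κ+1)/g`, `ξ = max(8, 4(κ+1)/g)`, `κ = lrRate Δ`.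
[cite: BachmannEtAl2019, Proposition 2.4 (Assumption (v))] -/
theorem coord_clustering [NeZero L] (hc : IsCoordFn coord G) {Δ : ℕ}
    (hΔ : ∀ x : Λ, (Finset.univ.filter fun y => G.Adj x y).card ≤ Δ) (t U μ : ℝ) {g : ℝ} (hg : 0 < g)
    (hgap : (hamiltonianWith G t U μ).HasSpectralGap g) {ψ : Fock (Orb Λ)}
    (hψ : (hamiltonianWith G t U μ).IsGroundStateVector ψ) (hψ1 : star ψ ⬝ᵥ ψ = 1)
    {X Y : Finset Λ} {A B : Matrix (Finset (Orb Λ)) (Finset (Orb Λ)) ℂ}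
    (hA : A ∈ carSubalgebra (orbSet X)) (hB : B ∈ carSubalgebra (orbSet Y)) (hAB : A * B = B * A)
    (hX : X.Nonempty) (hY : Y.Nonempty) {D : ℕ} (hD : ∀ x ∈ X, ∀ y ∈ Y, D ≤ circDist (coord x) (coord y))
    (hDlarge : max (2 * (lrRate Δ t U μ + 1)) 1 ≤ (D : ℝ) - 1) :
    ‖opExpect (A * B) ψ - opExpect A ψ * opExpect B ψ‖ ≤
      (2 + 4 * hubbardJ t U μ + 4 * (4 * hubbardJ t U μ * (2 * Δ + 1)) / ((lrRate Δ t U μ + 1) * 1) +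
          8 * (lrRate Δ t U μ + 1) / g) * ‖A‖ * ‖B‖ * ((2 * Δ + 1) * ((max X.card Y.card : ℕ) : ℝ)) *
        Real.exp (-((D : ℝ) - 1) / max (8 / 1) (4 * (lrRate Δ t U μ + 1) / g)) := by
  have hJ := hubbardJ_nonneg t U μ
  have hκ := lrRate_nonneg Δ t U μ
  have hH := isHermitian_hamiltonianWith G t U μ
  have hΔ1 : (1 : ℝ) ≤ 2 * Δ + 1 := by
    have : (0:ℝ) ≤ Δ := Nat.cast_nonneg _
    linarith
  have hm0 : (0 : ℝ) ≤ ((max X.card Y.card : ℕ) : ℝ) := Nat.cast_nonneg _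
  have hm1 : (1 : ℝ) ≤ ((max X.card Y.card : ℕ) : ℝ) := by
    have : 1 ≤ max X.card Y.card := le_max_of_le_left hX.card_pos
    exact_mod_cast this
  have hcY : (1 : ℝ) ≤ (2 * Δ + 1) * ((max X.card Y.card : ℕ) : ℝ) := by nlinarith
  have hm : ((max X.card Y.card : ℕ) : ℝ) ≤ (2 * Δ + 1) * ((max X.card Y.card : ℕ) : ℝ) := by nlinarith
  refine clustering_of_commutator_bounds hH hg (by positivity) one_pos (by linarith) hJ hcY hm0 hm hgap hψ hψ1
    hAB ?_ ?_ hDlarge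
  · -- Lipschitz input
    refine (norm_commutator_hamiltonianWith_le_of_mem G hΔ t U μ hB).trans ?_
    have hYle : ((Y.card * (2 * Δ + 1) : ℕ) : ℝ) ≤ (2 * Δ + 1) * ((max X.card Y.card : ℕ) : ℝ) := by
      have : (Y.card : ℝ) ≤ ((max X.card Y.card : ℕ) : ℝ) := by exact_mod_cast le_max_right _ _
      push_cast at this ⊢
      nlinarith [Nat.cast_nonneg (α := ℝ) Δ]
    have hB0 : 0 ≤ 2 * ‖B‖ := by positivity
    exact mul_le_mul_of_nonneg_left (mul_le_mul_of_nonneg_right hYle hJ) hB0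
  · -- Lieb–Robinson input, both time directions
    intro u
    have h := coord_lr G coord hc hΔ t U μ hB hA hAB.symm hY hX
      (fun y hy x hx => by rw [circDist_comm]; exact hD x hx y hy) u
    rw [max_comm] at h
    refine h.trans ?_
    have hexp := abs_mul_exp_le (lrRate Δ t U μ) u
    have hC0 : 0 ≤ 4 * hubbardJ t U μ * (2 * Δ + 1) * ((max X.card Y.card : ℕ) : ℝ) * ‖B‖ * ‖A‖ := by
      positivity
    calc 4 * hubbardJ t U μ * (2 * Δ + 1) * ((max X.card Y.card : ℕ) : ℝ) * ‖B‖ * ‖A‖ * |u| *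
          Real.exp (lrRate Δ t U μ * |u| - (D - 1))
        = 4 * hubbardJ t U μ * (2 * Δ + 1) * ((max X.card Y.card : ℕ) : ℝ) * ‖B‖ * ‖A‖ *
            (|u| * Real.exp (lrRate Δ t U μ * |u|)) * Real.exp (-((D : ℝ) - 1)) := by
          rw [sub_eq_add_neg, Real.exp_add]; ring
      _ ≤ 4 * hubbardJ t U μ * (2 * Δ + 1) * ((max X.card Y.card : ℕ) : ℝ) * ‖B‖ * ‖A‖ *
            Real.exp ((lrRate Δ t U μ + 1) * |u|) * Real.exp (-((D : ℝ) - 1)) := by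
          gcongr
      _ = 4 * hubbardJ t U μ * (2 * Δ + 1) * ‖B‖ * ‖A‖ * ((max X.card Y.card : ℕ) : ℝ) *
            Real.exp (-1 * ((D : ℝ) - 1 - (lrRate Δ t U μ + 1) * |u|)) := by
          rw [mul_assoc (4 * hubbardJ t U μ * (2 * Δ + 1) * ((max X.card Y.card : ℕ) : ℝ) * ‖B‖ * ‖A‖),
            ← Real.exp_add]
          ring_nf

/-! ### Boundary currents through a window and the quasi-adiabatic operators `K`, `K̃` -/

/-- **The current of the charge of the slab over `S` through the window `P`**: the part
`J(S,P) = Σ_{Z crossing ∂(slab S), supp Z ⊆ slab P} [Q^σ_{slab S}, Φ_Z]` of `[Q, H]` carried by the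
terms inside the slab over `P` (BBDF Prop. 2.4: `[Q,H] = J_- + J_+`, "a sum of two terms supported
in the strips `∂^R_±`"). [cite: BachmannEtAl2019, Proposition 2.4 (proof)] -/
def windowCurrent (t U μ : ℝ) (σ : Fin 2) (S P : Finset (ZMod L)) : Matrix (Finset (Orb Λ)) (Finset (Orb Λ)) ℂ :=
  ∑ Z ∈ (crossing G (cslab coord S)).filter (fun Z => hubbardTermSupp G Z ⊆ cslab coord P),
    (setCharge σ (cslab coord S) * hubbardTermOp G t U μ Z - hubbardTermOp G t U μ Z * setCharge σ (cslab coord S))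

/-- The window current is an even element of the CAR algebra of the window slab. [folklore] -/
theorem windowCurrent_mem (t U μ : ℝ) (σ : Fin 2) (S P : Finset (ZMod L)) :
    windowCurrent G coord t U μ σ S P ∈ carEvenSubalgebra (orbSet (cslab coord P)) := by
  unfold windowCurrent
  refine Subalgebra.sum_mem _ fun Z hZ => ?_
  rw [Finset.mem_filter] at hZ
  exact carEvenSubalgebra_mono (orbSet_mono hZ.2) (setCharge_commutator_hubbardTermOp_mem G t U μ σ _ Z)

/-- The window current is anti-Hermitian. [folklore] -/
theorem conjTranspose_windowCurrent (t U μ : ℝ) (σ : Fin 2) (S P : Finset (ZMod L)) :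
    (windowCurrent G coord t U μ σ S P)ᴴ = -windowCurrent G coord t U μ σ S P := by
  unfold windowCurrent
  rw [conjTranspose_sum, ← Finset.sum_neg_distrib]
  exact Finset.sum_congr rfl fun Z _ => conjTranspose_setCharge_commutator_hubbardTermOp G t U μ σ _ Z

/-- Norm bound of the window current: `‖J(S,P)‖ ≤ |slab P| (2Δ+1) · 4J`. [folklore] -/
theorem norm_windowCurrent_le {Δ : ℕ} (hΔ : ∀ x : Λ, (Finset.univ.filter fun y => G.Adj x y).card ≤ Δ)
    (t U μ : ℝ) (σ : Fin 2) (S P : Finset (ZMod L)) :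
    ‖windowCurrent G coord t U μ σ S P‖ ≤ ((cslab coord P).card * (2 * Δ + 1) : ℕ) * (4 * hubbardJ t U μ) := by
  unfold windowCurrent
  have hterm : ∀ Z ∈ (crossing G (cslab coord S)).filter (fun Z => hubbardTermSupp G Z ⊆ cslab coord P),
      ‖setCharge σ (cslab coord S) * hubbardTermOp G t U μ Z - hubbardTermOp G t U μ Z * setCharge σ (cslab coord S)‖ ≤
        4 * hubbardJ t U μ := fun Z _ => norm_setCharge_commutator_hubbardTermOp_le G t U μ σ _ Z
  have h1 := Finset.sum_le_card_nsmul _ _ _ hterm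
  rw [nsmul_eq_mul] at h1
  have hsub : (crossing G (cslab coord S)).filter (fun Z => hubbardTermSupp G Z ⊆ cslab coord P) ⊆
      Finset.univ.filter (fun Z : HubbardIdx G => ¬ Disjoint (hubbardTermSupp G Z) (cslab coord P)) := by
    intro Z hZ
    rw [Finset.mem_filter] at hZ ⊢
    refine ⟨Finset.mem_univ _, fun hd => ?_⟩
    obtain ⟨z, hz⟩ := hubbardTermSupp_nonempty G Z
    exact Finset.disjoint_left.1 hd hz (hZ.2 hz)
  have hcard : (((crossing G (cslab coord S)).filter (fun Z => hubbardTermSupp G Z ⊆ cslab coord P)).card : ℝ) ≤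
      ((cslab coord P).card * (2 * Δ + 1) : ℕ) := by
    exact_mod_cast (Finset.card_le_card hsub).trans (card_filter_not_disjoint_hubbardTermSupp_le G hΔ _)
  have hJ := hubbardJ_nonneg t U μ
  refine (norm_sum_le _ _).trans (h1.trans ?_)
  exact mul_le_mul_of_nonneg_right hcard (by positivity)

/-- **Decomposition of the charge–Hamiltonian commutator into two window currents**
(BBDF Prop. 2.4, proof: `[Q, H] = J_- + J_+`): if every term crossing the boundary of the slab over
`S` lies in the window slab over `P₁` or over `P₂`, and these are disjoint, then
`[Q^σ_{slab S}, H] = J(S,P₁) + J(S,P₂)`. [cite: BachmannEtAl2019, Proposition 2.4 (proof)] -/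
theorem setCharge_commutator_eq_add_windowCurrent (t U μ : ℝ) (σ : Fin 2) {S P₁ P₂ : Finset (ZMod L)}
    (hP : Disjoint P₁ P₂)
    (hcover : ∀ Z ∈ crossing G (cslab coord S), hubbardTermSupp G Z ⊆ cslab coord P₁ ∨ hubbardTermSupp G Z ⊆ cslab coord P₂) :
    setCharge σ (cslab coord S) * hamiltonianWith G t U μ - hamiltonianWith G t U μ * setCharge σ (cslab coord S) =
      windowCurrent G coord t U μ σ S P₁ + windowCurrent G coord t U μ σ S P₂ := by
  rw [setCharge_commutator_hamiltonianWith, windowCurrent, windowCurrent, ← Finset.sum_union]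
  · refine Finset.sum_congr ?_ fun Z _ => rfl
    ext Z
    simp only [Finset.mem_union, Finset.mem_filter]
    constructor
    · intro hZ
      rcases hcover Z hZ with h | h
      · exact Or.inl ⟨hZ, h⟩
      · exact Or.inr ⟨hZ, h⟩
    · rintro (⟨hZ, -⟩ | ⟨hZ, -⟩) <;> exact hZ
  · rw [Finset.disjoint_left]
    rintro Z hZ₁ hZ₂
    rw [Finset.mem_filter] at hZ₁ hZ₂
    obtain ⟨z, hz⟩ := hubbardTermSupp_nonempty G Z
    have h1 := hZ₁.2 hz
    have h2 := hZ₂.2 hz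
    rw [mem_cslab] at h1 h2
    exact Finset.disjoint_left.1 hP h1 h2

/-- The generator is additive in the observable. [folklore] -/
theorem qaGenerator_add' {H : Matrix (Finset (Orb Λ)) (Finset (Orb Λ)) ℂ} (hH : H.IsHermitian) {γ : ℝ}
    (hγ : γ ≠ 0) (A B : Matrix (Finset (Orb Λ)) (Finset (Orb Λ)) ℂ) :
    qaGenerator γ H (A + B) = qaGenerator γ H A + qaGenerator γ H B := by
  unfold qaGenerator
  rw [← MeasureTheory.integral_add (integrable_qaWeight_smul_heisenbergEvolution hH hγ A)
    (integrable_qaWeight_smul_heisenbergEvolution hH hγ B)]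
  refine congrArg (fun F : ℝ → Matrix (Finset (Orb Λ)) (Finset (Orb Λ)) ℂ => ∫ t, F t) (funext fun t => ?_)
  rw [← smul_add]
  congr 1
  simp only [heisenbergEvolution, Matrix.mul_add, Matrix.add_mul]

/-- **BBDF's `K̃ = i𝓘^H_γ(J)`** for the window current `J = J(S,P)` of the full Hamiltonian.
[cite: BachmannEtAl2019, Proposition 2.4 (proof, eq. (2.12))] -/
def kTilde (t U μ γ : ℝ) (σ : Fin 2) (S P : Finset (ZMod L)) : Matrix (Finset (Orb Λ)) (Finset (Orb Λ)) ℂ :=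
  I • qaGenerator γ (hamiltonianWith G t U μ) (windowCurrent G coord t U μ σ S P)

/-- **The strictly local approximant `K = i𝓘^{H_B}_γ(J)`** of `K̃`, generated by the local
Hamiltonian of the slab over `B ⊇ P` (BBDF Prop. 2.4: "one can find approximants
`K_± ∈ 𝒜_{∂_±^{L/16}}` satisfying `K̃_± = K_± + O(L^{-∞})`"; here the approximant is the
generator of the truncated dynamics). [cite: BachmannEtAl2019, Proposition 2.4 (proof)] -/
def kLoc (t U μ γ : ℝ) (σ : Fin 2) (S P B : Finset (ZMod L)) : Matrix (Finset (Orb Λ)) (Finset (Orb Λ)) ℂ :=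
  I • qaGenerator γ (localHubbard G t U μ (cslab coord B)) (windowCurrent G coord t U μ σ S P)

/-- `K̃` is Hermitian. [folklore] -/
theorem isHermitian_kTilde (t U μ γ : ℝ) (σ : Fin 2) (S P : Finset (ZMod L)) :
    (kTilde G coord t U μ γ σ S P).IsHermitian :=
  isHermitian_I_smul_qaGenerator (isHermitian_hamiltonianWith G t U μ) (conjTranspose_windowCurrent G coord t U μ σ S P) γ

/-- `K` is Hermitian. [folklore] -/
theorem isHermitian_kLoc (t U μ γ : ℝ) (σ : Fin 2) (S P B : Finset (ZMod L)) :
    (kLoc G coord t U μ γ σ S P B).IsHermitian :=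
  isHermitian_I_smul_qaGenerator (isHermitian_localHubbard G t U μ _) (conjTranspose_windowCurrent G coord t U μ σ S P) γ

/-- **`K` is strictly local**: an even element of the CAR algebra of the slab over `B ⊇ P`.
[folklore] -/
theorem kLoc_mem (t U μ γ : ℝ) (σ : Fin 2) {S P B : Finset (ZMod L)} (hPB : P ⊆ B) :
    kLoc G coord t U μ γ σ S P B ∈ carEvenSubalgebra (orbSet (cslab coord B)) := by
  unfold kLoc
  refine Subalgebra.smul_mem _ ?_ _
  exact qaGenerator_mem_subalgebra _ (isHermitian_localHubbard G t U μ _) (localHubbard_mem_carEvenSubalgebra G t U μ _)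
    (carEvenSubalgebra_mono (orbSet_mono (cslab_mono coord hPB)) (windowCurrent_mem G coord t U μ σ S P)) γ

/-- Norm bound `‖K‖ ≤ (‖W₁‖₁/γ) ‖J‖`. [folklore] -/
theorem norm_kLoc_le (t U μ : ℝ) {γ : ℝ} (hγ : 0 < γ) (σ : Fin 2) (S P B : Finset (ZMod L)) :
    ‖kLoc G coord t U μ γ σ S P B‖ ≤ qaWeightL1 / γ * ‖windowCurrent G coord t U μ σ S P‖ := by
  unfold kLoc
  rw [norm_smul, Complex.norm_I, one_mul]
  exact norm_qaGenerator_le (isHermitian_localHubbard G t U μ _) hγ _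

/-- Norm bound `‖K̃‖ ≤ (‖W₁‖₁/γ) ‖J‖`. [folklore] -/
theorem norm_kTilde_le (t U μ : ℝ) {γ : ℝ} (hγ : 0 < γ) (σ : Fin 2) (S P : Finset (ZMod L)) :
    ‖kTilde G coord t U μ γ σ S P‖ ≤ qaWeightL1 / γ * ‖windowCurrent G coord t U μ σ S P‖ := by
  unfold kTilde
  rw [norm_smul, Complex.norm_I, one_mul]
  exact norm_qaGenerator_le (isHermitian_hamiltonianWith G t U μ) hγ _

/-- **The unique gapped ground state is an EXACT eigenvector of `Q - K̃₁ - K̃₂`** (BBDF Prop. 2.4: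
"`Ω` is an exact eigenvector of `Q - K̃_+ - K̃_-`", from `qaGenerator_intertwines` and
`[Q,H] = J₁ + J₂`). [cite: BachmannEtAl2019, Proposition 2.4] -/
theorem setCharge_sub_kTilde_mulVec (t U μ : ℝ) (σ : Fin 2) {S P₁ P₂ : Finset (ZMod L)} (hP : Disjoint P₁ P₂)
    (hcover : ∀ Z ∈ crossing G (cslab coord S), hubbardTermSupp G Z ⊆ cslab coord P₁ ∨ hubbardTermSupp G Z ⊆ cslab coord P₂)
    {γ g : ℝ} (hγ : 0 < γ) (hγg : γ ≤ g) (hgap : (hamiltonianWith G t U μ).HasSpectralGap g)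
    {ψ : Fock (Orb Λ)} (hψ : (hamiltonianWith G t U μ).IsGroundStateVector ψ) (hψ1 : star ψ ⬝ᵥ ψ = 1) :
    (setCharge σ (cslab coord S) - kTilde G coord t U μ γ σ S P₁ - kTilde G coord t U μ γ σ S P₂) *ᵥ ψ =
      (star ψ ⬝ᵥ ((setCharge σ (cslab coord S) - kTilde G coord t U μ γ σ S P₁ - kTilde G coord t U μ γ σ S P₂) *ᵥ ψ)) • ψ := by
  have hH := isHermitian_hamiltonianWith G t U μ
  have key := qaGenerator_intertwines hH hγ hγg hgap hψ hψ1 (setCharge σ (cslab coord S))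
  have e : setCharge σ (cslab coord S) - I • qaGenerator γ (hamiltonianWith G t U μ)
      (setCharge σ (cslab coord S) * hamiltonianWith G t U μ - hamiltonianWith G t U μ * setCharge σ (cslab coord S)) =
      setCharge σ (cslab coord S) - kTilde G coord t U μ γ σ S P₁ - kTilde G coord t U μ γ σ S P₂ := by
    rw [setCharge_commutator_eq_add_windowCurrent G coord t U μ σ hP hcover, qaGenerator_add' hH hγ.ne',
      smul_add, kTilde, kTilde]
    abel
  rw [e] at key
  exact key

/-- **Locality of the quasi-adiabatic operator `K`** (BBDF Prop. 2.4: `K̃_± = K_± + O(L^{-∞})`),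
quantitatively: if every term of `H` not inside the slab over `B` keeps `x₁`-distance `≥ R` from the
window slab over `P` (nonempty), then for every `T ≥ 0` and `k`,
`‖K - K̃‖ ≤ η T ‖W₁‖₁/γ + 4‖J‖ C_k /(γ(1+γT)^{k+1})` with
`η = |Λ|(2Δ+1) · 4J(2Δ+1) max(2,|slab P|) J ‖J‖ T e^{κT - (R-1)}`
(Lieb–Robinson for each discarded term, `norm_qaGenerator_sub_qaGenerator_le_of_commutator`).
[cite: BachmannEtAl2019, Proposition 2.4 (proof)] -/
theorem norm_kLoc_sub_kTilde_le [NeZero L] (hc : IsCoordFn coord G) {Δ : ℕ}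
    (hΔ : ∀ x : Λ, (Finset.univ.filter fun y => G.Adj x y).card ≤ Δ) (t U μ : ℝ) {γ : ℝ} (hγ : 0 < γ)
    (σ : Fin 2) {S P B : Finset (ZMod L)} (hPne : (cslab coord P).Nonempty) {R : ℕ} (hR1 : 1 ≤ R)
    (hR : ∀ Z : HubbardIdx G, ¬ hubbardTermSupp G Z ⊆ cslab coord B →
      ∀ z ∈ hubbardTermSupp G Z, ∀ p ∈ cslab coord P, R ≤ circDist (coord z) (coord p))
    {T : ℝ} (hT : 0 ≤ T) (k : ℕ) :
    ‖kLoc G coord t U μ γ σ S P B - kTilde G coord t U μ γ σ S P‖ ≤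
      (Fintype.card Λ * (2 * Δ + 1) : ℕ) * (4 * hubbardJ t U μ * (2 * Δ + 1) * ((max 2 (cslab coord P).card : ℕ) : ℝ) *
          hubbardJ t U μ * ‖windowCurrent G coord t U μ σ S P‖ * T * Real.exp (lrRate Δ t U μ * T - (R - 1))) *
        T * (qaWeightL1 / γ) +
      2 * ‖windowCurrent G coord t U μ σ S P‖ * (2 * qaTailConst k / (γ * (1 + γ * T) ^ (k + 1))) := by
  classical
  set J := windowCurrent G coord t U μ σ S P with hJdef
  have hH := isHermitian_hamiltonianWith G t U μ
  have hHB := isHermitian_localHubbard G t U μ (cslab coord B)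
  have hJ0 := hubbardJ_nonneg t U μ
  have hκ := lrRate_nonneg Δ t U μ
  -- `K - K̃ = i(𝓘^{H_B}(J) - 𝓘^H(J))`
  have e : kLoc G coord t U μ γ σ S P B - kTilde G coord t U μ γ σ S P =
      I • (qaGenerator γ (localHubbard G t U μ (cslab coord B)) J - qaGenerator γ (hamiltonianWith G t U μ) J) := by
    rw [kLoc, kTilde, smul_sub]
  rw [e, norm_smul, Complex.norm_I, one_mul, norm_sub_rev]
  -- per-term bound, uniform in `|u| ≤ T`
  set η₁ : ℝ := 4 * hubbardJ t U μ * (2 * Δ + 1) * ((max 2 (cslab coord P).card : ℕ) : ℝ) *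
      hubbardJ t U μ * ‖J‖ * T * Real.exp (lrRate Δ t U μ * T - (R - 1)) with hη₁
  have hη₁0 : 0 ≤ η₁ := by positivity
  have hterm : ∀ u : ℝ, |u| ≤ T → ∀ Z ∈ Finset.univ.filter (fun Z : HubbardIdx G => ¬ hubbardTermSupp G Z ⊆ cslab coord B),
      ‖heisenbergEvolution (hamiltonianWith G t U μ) u (hubbardTermOp G t U μ Z) * J -
        J * heisenbergEvolution (hamiltonianWith G t U μ) u (hubbardTermOp G t U μ Z)‖ ≤ η₁ := by
    intro u hu Z hZ
    rw [Finset.mem_filter] at hZ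
    have hRZ := hR Z hZ.2
    -- the two supports are disjoint (distance ≥ 1), so the term and `J` commute
    have hdisj : Disjoint (hubbardTermSupp G Z) (cslab coord P) := by
      rw [Finset.disjoint_left]
      intro z hz hzP
      have := hRZ z hz z hzP
      rw [circDist_self] at this
      omega
    have hcomm : hubbardTermOp G t U μ Z * J = J * hubbardTermOp G t U μ Z :=
      (commute_of_mem_carEvenSubalgebra (hubbardTermOp_mem_carEvenSubalgebra G t U μ Z)
        ((carEvenSubalgebra_le_carSubalgebra _) (windowCurrent_mem G coord t U μ σ S P)) (disjoint_orbSet hdisj)).eq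
    have h := coord_lr G coord hc hΔ t U μ
      ((carEvenSubalgebra_le_carSubalgebra _) (hubbardTermOp_mem_carEvenSubalgebra G t U μ Z))
      ((carEvenSubalgebra_le_carSubalgebra _) (windowCurrent_mem G coord t U μ σ S P)) hcomm
      (hubbardTermSupp_nonempty G Z) hPne hRZ u
    refine h.trans ?_
    rw [hη₁]
    have hcardZ : ((max (hubbardTermSupp G Z).card (cslab coord P).card : ℕ) : ℝ) ≤
        ((max 2 (cslab coord P).card : ℕ) : ℝ) := by
      have hle : (hubbardTermSupp G Z).card ≤ 2 := by
        cases Z with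
        | inl p => exact Finset.card_insert_le _ _ |>.trans (by simp)
        | inr x => simp [hubbardTermSupp]
      exact_mod_cast max_le_max hle le_rfl
    have hΦ : ‖hubbardTermOp G t U μ Z‖ ≤ hubbardJ t U μ := norm_hubbardTermOp_le G t U μ Z
    have hexp : Real.exp (lrRate Δ t U μ * |u| - (R - 1)) ≤ Real.exp (lrRate Δ t U μ * T - (R - 1)) := by
      apply Real.exp_le_exp.2
      have := mul_le_mul_of_nonneg_left hu hκ
      linarith
    have habs : |u| ≤ T := hu
    have h0 : 0 ≤ |u| := abs_nonneg u
    have hprod : 0 ≤ 4 * hubbardJ t U μ * (2 * ↑Δ + 1) * ((max 2 (cslab coord P).card : ℕ) : ℝ) *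
        hubbardJ t U μ * ‖J‖ * T :=
      mul_nonneg (mul_nonneg (mul_nonneg (mul_nonneg (mul_nonneg (mul_nonneg (by norm_num) hJ0)
        (by positivity)) (Nat.cast_nonneg _)) hJ0) (norm_nonneg _)) hT
    gcongr
  -- the commutator with the difference of the Hamiltonians
  have hcount : ((Finset.univ.filter (fun Z : HubbardIdx G => ¬ hubbardTermSupp G Z ⊆ cslab coord B)).card : ℝ) ≤
      (Fintype.card Λ * (2 * Δ + 1) : ℕ) := by
    have h1 : (Finset.univ.filter (fun Z : HubbardIdx G => ¬ hubbardTermSupp G Z ⊆ cslab coord B)).card ≤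
        (Finset.univ.filter (fun Z : HubbardIdx G => ¬ Disjoint (hubbardTermSupp G Z) Finset.univ)).card := by
      refine Finset.card_le_card fun Z hZ => ?_
      rw [Finset.mem_filter] at hZ ⊢
      refine ⟨Finset.mem_univ _, fun hd => ?_⟩
      obtain ⟨z, hz⟩ := hubbardTermSupp_nonempty G Z
      exact Finset.disjoint_left.1 hd hz (Finset.mem_univ z)
    have h2 := card_filter_not_disjoint_hubbardTermSupp_le G hΔ (Finset.univ : Finset Λ)
    rw [Finset.card_univ] at h2
    exact_mod_cast h1.trans h2
  have hη : ∀ u : ℝ, |u| ≤ T →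
      ‖heisenbergEvolution (hamiltonianWith G t U μ) u (hamiltonianWith G t U μ - localHubbard G t U μ (cslab coord B)) * J -
        J * heisenbergEvolution (hamiltonianWith G t U μ) u (hamiltonianWith G t U μ - localHubbard G t U μ (cslab coord B))‖ ≤
        (Fintype.card Λ * (2 * Δ + 1) : ℕ) * η₁ := by
    intro u hu
    rw [hamiltonianWith_sub_localHubbard, heisenbergEvolution_finset_sum, finset_sum_commutator]
    refine (norm_sum_le _ _).trans ?_
    have h1 := Finset.sum_le_card_nsmul _ _ _ (hterm u hu)
    rw [nsmul_eq_mul] at h1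
    exact h1.trans (mul_le_mul_of_nonneg_right hcount hη₁0)
  have := norm_qaGenerator_sub_qaGenerator_le_of_commutator hH hHB hγ J hT (by positivity) hη k
  rw [hη₁] at this
  exact this

end CoordLR

end Literature.MathematicalPhysics.QuantumLattice

end
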